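import Summits.BirchSwinnertonDyer.BirchSwinnertonDyer.Theorems.ResidualThetaTransportAtTwoResidualSignedLambdaLowerCMAtTwoOfIntDualityData
import Summits.BirchSwinnertonDyer.BirchSwinnertonDyer.Theorems.ResidualThetaTransportAtTwoResidualSignedLambdaLowerCMAtTwoFourTermDuality
import Literature.NumberTheory.GaloisCohomology.BrauerSumTwoTorsionFiniteSet
import Literature.NumberTheory.EllipticCurves.CyclotomicLayerPairingOfFun
import Literature.NumberTheory.GaloisRepresentations.ContinuousCorestriction
import Mathlib.Algebra.Module.CharacterModule
import HarnessLib

/-!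
# The reciprocity receptacle of RSL_g: the `2 •`-rescaling adapters of the duality entries, the `ℤ/2^k → ℚ/ℤ` value
# currency, and the levelwise assembly of (EH) from the per-place orbit evaluations

Helper file for crux RSL_g `ResidualSignedLambdaLowerCMAtTwo` (stmt-BirchSwinnertonDyer-22608, route `ResidualThetaTransportAtTwo`),
stub `stub_reciprocity` (EH) of the lead's skeleton `onepair` (STUB-PLAN rev 13 §0 (3), S52/S53, Q56). THEOREMS ONLY; nothing here
closes an item; BSD is NOT proved by any of this.

* §A1 (the `N •` ADAPTER of the N5 entry p664041 `CharIdealLambda.le_finrank_baseChange_characterModule_of_duality_decorated`, module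
  dialect `pair : P →ₗ[A] Sel⋆`): (EH) may be WEAKENED to `(EH_N) ∀ z ∈ Z, N • pair (locd z) = 0` for one `N ≠ 0` — replace `pair`
  by `N • pair`; (ORTH) is inherited, (DH) keeps its slack `a ↦ a·N`, the counts do not see `pair`
  (`le_finrank_baseChange_characterModule_of_duality_decorated_of_smul`, `…_of_two_nsmul`).
* §A2 (the same adapter for the v2 ENTRY p679392 `LambdaLowerBoundO.le_finrank_characterModule_of_intDualityData`, additive mixed
  `ℤ₂/𝒪` dialect `pair : P →+ Sg⋆`): `le_finrank_characterModule_of_intDualityData_of_nsmul`, `…_of_two_nsmul` — so the reciprocity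
  stub may be CONSUMED in its honest `2 •`-form (EH₂) `∀ x ∈ Z, 2 • pair (locd x) = 0` with no other change to the entry's datum.
* §Z the (C3) value currency `ℤ/p^k → ℚ/ℤ`, `t ↦ t.val • p^{-k}`: `nsmul_val_smul_invPow_eq_zero` (`N • t = 0 ⇒ N • (t.val • p^{-k}) = 0`),
  `val_smul_invPow_eq_zero`.
* §L the LEVELWISE assembly of (EH) in the (C3)/(C5) currency (`CyclotomicLayer.layerPairingH1Of`): GIVEN the per-place evaluations
  of the invariants of a global class `c ∈ H²(Γ_ℚ, μ_N)` at `v ∈ S₁` as ORBIT SUMS of layer pairings of conjugates (the outputs of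
  `map_cupProduct_coindFin_shapiroLift[_sum]`, `ContinuousShapiroLiftRestrictHom` / `ContinuousShapiroLiftMackeyCup`) and the
  vanishing of its localisations at the finite `v ∉ S₁` (`CupProductLocalTermsShapiro`: (ShU) + (U)), the double sum is `2`-torsion
  (`two_nsmul_sum_orbit_layerPairingH1Of_eq_zero`), and vanishes exactly if the archimedean localisations vanish
  (`sum_orbit_layerPairingH1Of_eq_zero_of_localization_inl_eq_zero`) — `BrauerSumTwoTorsionFiniteSet`.

§A1, §Z are the kernel-checked §A/§Z of the crux sketch `Cruxes/ResidualThetaCountLowerPureAtTwo/Sketch_sidea_k1_g10.lean` (stub-ideation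
seat k1 gen 10) and §L is §4 of `Sketch_sidea_k2_g10.lean` (seat k2 gen 10), landed as theorems; §A2 is new (same three lines in the
entry's additive dialect, STUB-PLAN rev 13 V54/S53).

References: [Kobayashi2003] S. Kobayashi, Invent. math. 152 (2003), Thm. 7.3 ((7.16)–(7.21)); [Kato2004Asterisque] K. Kato,
Astérisque 295 (2004), §17.13; [MilneADT2006] J. S. Milne, *Arithmetic Duality Theorems* (2006), I Thm. 4.10 (b);
[CasselsFrohlichANT1967] Ch. VII §11.
-/

set_option autoImplicit false
-- the Theorems namespace of this sub repeats the summit name by design (D-0017 nested layout)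
set_option linter.dupNamespace false

noncomputable section

open CategoryTheory Function Field NumberField IsDedekindDomain
open scoped NumberField TensorProduct

namespace Summit.BirchSwinnertonDyer.BirchSwinnertonDyer.Theorems.ReciprocityReceptacle

open _root_.ContinuousCohomology _root_.TopRep
open Literature.NumberTheory.GaloisRepresentations
open Literature.NumberTheory.GaloisRepresentations.DiscreteGaloisModule
open Literature.NumberTheory.GaloisCohomology

universe u v w

/-! ## §A1 The `N •` adapter of the N5 entry (module dialect `pair : P →ₗ[A] Sel⋆`) -/

section AdapterLinear

variable {A : Type u} [CommRing A]
  {Sel : Type v} [AddCommGroup Sel] [Module A Sel]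
  {P : Type v} [AddCommGroup P] [Module A P]
  {H : Type v} [AddCommGroup H] [Module A H]
  (pair : P →ₗ[A] CharacterModule Sel) (locd : H →ₗ[A] P) (Z : Submodule A H) (Sel₀ : Submodule A Sel)

/-- (EH_N) for `pair` is (EH) for `N • pair`. [cite: Kobayashi2003, Thm. 7.3 ((7.21), p. 13)] -/
theorem eh_smul (N : A) (hEH : ∀ z ∈ Z, N • pair (locd z) = 0) : ∀ z ∈ Z, (N • pair) (locd z) = 0 := by
  intro z hz
  rw [LinearMap.smul_apply]
  exact hEH z hz

/-- (ORTH) for `pair` gives (ORTH) for `N • pair` (`Sel₀` is a submodule; the `A`-action on `Sel⋆` is `(a • φ) s = φ (a • s)`).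
[cite: Kobayashi2003, Thm. 7.3 ((7.21), p. 13)] -/
theorem orth_smul (N : A) (horth : ∀ s ∈ Sel₀, ∀ z : P, pair z s = 0) : ∀ s ∈ Sel₀, ∀ z : P, (N • pair) z s = 0 := by
  intro s hs z
  rw [LinearMap.smul_apply, CharacterModule.smul_apply]
  exact horth _ (Sel₀.smul_mem N hs) z

/-- (DH) for `pair` gives (DH) for `N • pair`, `N ≠ 0`, with slack `a ↦ a * N` (domain). [cite: Kobayashi2003, Thm. 7.3 ((7.21), p. 13)] -/
theorem dh_smul [NoZeroDivisors A] {N : A} (hN : N ≠ 0)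
    (hDH : ∀ z : P, pair z = 0 → ∃ a : A, a ≠ 0 ∧ ∃ x : H, a • z = locd x) :
    ∀ z : P, (N • pair) z = 0 → ∃ a : A, a ≠ 0 ∧ ∃ x : H, a • z = locd x := by
  intro z hz
  rw [LinearMap.smul_apply, ← map_smul] at hz
  obtain ⟨a, ha, x, hx⟩ := hDH (N • z) hz
  exact ⟨a * N, mul_ne_zero ha hN, x, by rw [mul_smul]; exact hx⟩

/-- **The N5 entry with (EH) weakened to (EH_N)**: `∃ N ≠ 0` killing `pair ∘ locd` on `Z` suffices (apply p664041 to `N • pair`).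
[cite: Kobayashi2003, Thm. 7.3 ((7.21), p. 13)] [cite: BurungaleTian2026, Thm. 2.6 (p. 5)] -/
theorem le_finrank_baseChange_characterModule_of_duality_decorated_of_smul
    (K : Type w) [Field K] [Algebra A K] [IsFractionRing A K]
    {H2 : Type v} [AddCommGroup H2] [Module A H2] {N : A} (hN : N ≠ 0)
    (hEH : ∀ z ∈ Z, N • pair (locd z) = 0) (horth : ∀ s ∈ Sel₀, ∀ z : P, pair z s = 0)
    (hDH : ∀ z : P, pair z = 0 → ∃ a : A, a ≠ 0 ∧ ∃ x : H, a • z = locd x)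
    [Module.Finite K (K ⊗[A] (H ⧸ Z))] [Module.Finite K (K ⊗[A] (P ⧸ Z.map locd))]
    [Module.Finite K (K ⊗[A] CharacterModule Sel)] {d e : ℕ}
    (hi : d + e ≤ Module.finrank K (K ⊗[A] (P ⧸ Z.map locd)))
    (hii : Module.finrank K (K ⊗[A] (H ⧸ Z)) ≤ Module.finrank K (K ⊗[A] H2) + e)
    (hPT : Module.finrank K (K ⊗[A] H2) ≤ Module.finrank K (K ⊗[A] CharacterModule Sel₀)) :
    d ≤ Module.finrank K (K ⊗[A] CharacterModule Sel) := by
  haveI : NoZeroDivisors A :=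
    (IsFractionRing.injective A K).noZeroDivisors (algebraMap A K) (map_zero _) (map_mul _)
  exact CharIdealLambda.le_finrank_baseChange_characterModule_of_duality_decorated K (N • pair) locd Z Sel₀
    (eh_smul pair locd Z N hEH) (orth_smul pair Sel₀ N horth) (dh_smul pair locd hN hDH) hi hii hPT

/-- **The `2 •` form (EH₂) of the N5 entry**: `2 • pair (locd z) = 0` on `Z` suffices as soon as `(2 : A) ≠ 0`.
[cite: Kobayashi2003, Thm. 7.3 ((7.21), p. 13)] [cite: BurungaleTian2026, Thm. 2.6 (p. 5)] -/
theorem le_finrank_baseChange_characterModule_of_duality_decorated_of_two_nsmul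
    (K : Type w) [Field K] [Algebra A K] [IsFractionRing A K]
    {H2 : Type v} [AddCommGroup H2] [Module A H2] (h2 : (2 : A) ≠ 0)
    (hEH : ∀ z ∈ Z, 2 • pair (locd z) = 0) (horth : ∀ s ∈ Sel₀, ∀ z : P, pair z s = 0)
    (hDH : ∀ z : P, pair z = 0 → ∃ a : A, a ≠ 0 ∧ ∃ x : H, a • z = locd x)
    [Module.Finite K (K ⊗[A] (H ⧸ Z))] [Module.Finite K (K ⊗[A] (P ⧸ Z.map locd))]
    [Module.Finite K (K ⊗[A] CharacterModule Sel)] {d e : ℕ}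
    (hi : d + e ≤ Module.finrank K (K ⊗[A] (P ⧸ Z.map locd)))
    (hii : Module.finrank K (K ⊗[A] (H ⧸ Z)) ≤ Module.finrank K (K ⊗[A] H2) + e)
    (hPT : Module.finrank K (K ⊗[A] H2) ≤ Module.finrank K (K ⊗[A] CharacterModule Sel₀)) :
    d ≤ Module.finrank K (K ⊗[A] CharacterModule Sel) :=
  le_finrank_baseChange_characterModule_of_duality_decorated_of_smul pair locd Z Sel₀ K h2
    (fun z hz ↦ by rw [two_smul, ← two_nsmul]; exact hEH z hz) horth hDH hi hii hPT

end AdapterLinear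

/-! ## §A2 The `N •` adapter of the v2 entry (additive mixed `ℤ_p/𝒪` dialect `pair : P →+ Sg⋆`) -/

section AdapterAdditive

open Literature.NumberTheory.EllipticCurves

/-- **The v2 entry p679392 with (EH) weakened to (EH_N)**: for `N : ℕ` with `(N : ℤ_p) ≠ 0`, the datum of
`LambdaLowerBoundO.le_finrank_characterModule_of_intDualityData` with `∀ x ∈ Z, N • pair (locd x) = 0` in place of `pair (locd x) = 0`
gives the same count (apply the entry to `N • pair`: the `ℤ_p`-compatibility, (ORTH) and (DH) — with slack `a ↦ a * N` — are inherited).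
[cite: Kobayashi2003, Thm. 7.3 ((7.21), p. 13)] [cite: BurungaleTian2026, Thm. 2.6 (p. 5)] -/
theorem le_finrank_characterModule_of_intDualityData_of_nsmul {p : ℕ} [Fact p.Prime] (S : Set (PadicAlgCl p))
    [FiniteDimensional ℚ_[p] (padicCoeffField S)]
    {Sel : Type} [AddCommGroup Sel] [Module ↥(padicCoeffIntegers S) Sel]
    [Module.Finite (FractionRing ↥(padicCoeffIntegers S))
      (TensorProduct ↥(padicCoeffIntegers S) (FractionRing ↥(padicCoeffIntegers S)) (CharacterModule Sel))]
    (P : Type) [AddCommGroup P] [Module ℤ_[p] P] (H : Type) [AddCommGroup H] [Module ↥(padicCoeffIntegers S) H]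
    (H2 : Type) [AddCommGroup H2] [Module ↥(padicCoeffIntegers S) H2]
    (pair : P →+ CharacterModule Sel) (locd : H →+ P) (Z : Submodule ↥(padicCoeffIntegers S) H)
    (Sel₀ : Submodule ↥(padicCoeffIntegers S) Sel)
    (e f : ℕ) (B : (Fin f → ℤ_[p]) ≃+ ↥(padicCoeffIntegers S))
    (hB : ∀ (z : ℤ_[p]) (c : Fin f → ℤ_[p]), B (z • c) = padicIntToCoeffIntegers S z * B c)
    (hpair : ∀ (z : ℤ_[p]) (t : P) (s : Sel), pair (z • t) s = pair t (padicIntToCoeffIntegers S z • s))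
    (hlocd : ∀ (z : ℤ_[p]) (x : H), locd (padicIntToCoeffIntegers S z • x) = z • locd x)
    {N : ℕ} (hN : (N : ℤ_[p]) ≠ 0)
    (hEH : ∀ x ∈ Z, N • pair (locd x) = 0) (horth : ∀ s ∈ Sel₀, ∀ t : P, pair t s = 0)
    (hDH : ∀ t : P, pair t = 0 → ∃ a : ℤ_[p], a ≠ 0 ∧ ∃ x : H, a • t = locd x)
    (hfinH : Module.Finite (FractionRing ↥(padicCoeffIntegers S))
      (TensorProduct ↥(padicCoeffIntegers S) (FractionRing ↥(padicCoeffIntegers S)) (H ⧸ Z)))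
    (hfinP : Module.Finite ℚ_[p] (TensorProduct ℤ_[p] ℚ_[p] (P ⧸ Submodule.span ℤ_[p] (locd '' (Z : Set H)))))
    {m : ℕ} (hi : f * (m + e) ≤ Module.finrank ℚ_[p] (TensorProduct ℤ_[p] ℚ_[p] (P ⧸ Submodule.span ℤ_[p] (locd '' (Z : Set H)))))
    (hii : Module.finrank (FractionRing ↥(padicCoeffIntegers S))
        (TensorProduct ↥(padicCoeffIntegers S) (FractionRing ↥(padicCoeffIntegers S)) (H ⧸ Z)) ≤
      Module.finrank (FractionRing ↥(padicCoeffIntegers S))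
        (TensorProduct ↥(padicCoeffIntegers S) (FractionRing ↥(padicCoeffIntegers S)) H2) + e)
    (hPT : Module.finrank (FractionRing ↥(padicCoeffIntegers S))
        (TensorProduct ↥(padicCoeffIntegers S) (FractionRing ↥(padicCoeffIntegers S)) H2) ≤
      Module.finrank (FractionRing ↥(padicCoeffIntegers S))
        (TensorProduct ↥(padicCoeffIntegers S) (FractionRing ↥(padicCoeffIntegers S)) (CharacterModule ↥Sel₀))) :
    m ≤ Module.finrank (FractionRing ↥(padicCoeffIntegers S))
      (TensorProduct ↥(padicCoeffIntegers S) (FractionRing ↥(padicCoeffIntegers S)) (CharacterModule Sel)) := by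
  refine LambdaLowerBoundO.le_finrank_characterModule_of_intDualityData S P H H2 (N • pair) locd Z Sel₀ e f B hB
    (fun z t s ↦ ?_) hlocd (fun x hx ↦ ?_) (fun s hs t ↦ ?_) (fun t ht ↦ ?_) hfinH hfinP hi hii hPT
  · -- `ℤ_p`-compatibility of `N • pair`
    rw [AddMonoidHom.nsmul_apply, AddMonoidHom.nsmul_apply]
    change N • pair (z • t) s = N • pair t (padicIntToCoeffIntegers S z • s)
    rw [hpair]
  · -- (EH_N) ⇒ (EH) for `N • pair`
    rw [AddMonoidHom.nsmul_apply]
    exact hEH x hx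
  · -- (ORTH) for `N • pair`
    rw [AddMonoidHom.nsmul_apply]
    change N • pair t s = 0
    rw [horth s hs t, nsmul_zero]
  · -- (DH) for `N • pair`, slack `a ↦ a * N`
    rw [AddMonoidHom.nsmul_apply, ← map_nsmul] at ht
    obtain ⟨a, ha, x, hx⟩ := hDH (N • t) ht
    refine ⟨a * N, mul_ne_zero ha hN, x, ?_⟩
    rw [mul_smul, Nat.cast_smul_eq_nsmul]
    exact hx

/-- **The `2 •` form (EH₂) of the v2 entry**: with `∀ x ∈ Z, 2 • pair (locd x) = 0` in place of (EH), the count of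
`LambdaLowerBoundO.le_finrank_characterModule_of_intDualityData` still holds (`(2 : ℤ_p) ≠ 0`). This is the form in which the
reciprocity stub (EH) of RSL_g is consumed if it is landed with its honest factor `2` (real places; STUB-PLAN rev 13 S53).
[cite: Kobayashi2003, Thm. 7.3 ((7.21), p. 13)] [cite: BurungaleTian2026, Thm. 2.6 (p. 5)] -/
theorem le_finrank_characterModule_of_intDualityData_of_two_nsmul {p : ℕ} [Fact p.Prime] (S : Set (PadicAlgCl p))
    [FiniteDimensional ℚ_[p] (padicCoeffField S)]
    {Sel : Type} [AddCommGroup Sel] [Module ↥(padicCoeffIntegers S) Sel]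
    [Module.Finite (FractionRing ↥(padicCoeffIntegers S))
      (TensorProduct ↥(padicCoeffIntegers S) (FractionRing ↥(padicCoeffIntegers S)) (CharacterModule Sel))]
    (P : Type) [AddCommGroup P] [Module ℤ_[p] P] (H : Type) [AddCommGroup H] [Module ↥(padicCoeffIntegers S) H]
    (H2 : Type) [AddCommGroup H2] [Module ↥(padicCoeffIntegers S) H2]
    (pair : P →+ CharacterModule Sel) (locd : H →+ P) (Z : Submodule ↥(padicCoeffIntegers S) H)
    (Sel₀ : Submodule ↥(padicCoeffIntegers S) Sel)
    (e f : ℕ) (B : (Fin f → ℤ_[p]) ≃+ ↥(padicCoeffIntegers S))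
    (hB : ∀ (z : ℤ_[p]) (c : Fin f → ℤ_[p]), B (z • c) = padicIntToCoeffIntegers S z * B c)
    (hpair : ∀ (z : ℤ_[p]) (t : P) (s : Sel), pair (z • t) s = pair t (padicIntToCoeffIntegers S z • s))
    (hlocd : ∀ (z : ℤ_[p]) (x : H), locd (padicIntToCoeffIntegers S z • x) = z • locd x)
    (hEH : ∀ x ∈ Z, 2 • pair (locd x) = 0) (horth : ∀ s ∈ Sel₀, ∀ t : P, pair t s = 0)
    (hDH : ∀ t : P, pair t = 0 → ∃ a : ℤ_[p], a ≠ 0 ∧ ∃ x : H, a • t = locd x)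
    (hfinH : Module.Finite (FractionRing ↥(padicCoeffIntegers S))
      (TensorProduct ↥(padicCoeffIntegers S) (FractionRing ↥(padicCoeffIntegers S)) (H ⧸ Z)))
    (hfinP : Module.Finite ℚ_[p] (TensorProduct ℤ_[p] ℚ_[p] (P ⧸ Submodule.span ℤ_[p] (locd '' (Z : Set H)))))
    {m : ℕ} (hi : f * (m + e) ≤ Module.finrank ℚ_[p] (TensorProduct ℤ_[p] ℚ_[p] (P ⧸ Submodule.span ℤ_[p] (locd '' (Z : Set H)))))
    (hii : Module.finrank (FractionRing ↥(padicCoeffIntegers S))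
        (TensorProduct ↥(padicCoeffIntegers S) (FractionRing ↥(padicCoeffIntegers S)) (H ⧸ Z)) ≤
      Module.finrank (FractionRing ↥(padicCoeffIntegers S))
        (TensorProduct ↥(padicCoeffIntegers S) (FractionRing ↥(padicCoeffIntegers S)) H2) + e)
    (hPT : Module.finrank (FractionRing ↥(padicCoeffIntegers S))
        (TensorProduct ↥(padicCoeffIntegers S) (FractionRing ↥(padicCoeffIntegers S)) H2) ≤
      Module.finrank (FractionRing ↥(padicCoeffIntegers S))
        (TensorProduct ↥(padicCoeffIntegers S) (FractionRing ↥(padicCoeffIntegers S)) (CharacterModule ↥Sel₀))) :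
    m ≤ Module.finrank (FractionRing ↥(padicCoeffIntegers S))
      (TensorProduct ↥(padicCoeffIntegers S) (FractionRing ↥(padicCoeffIntegers S)) (CharacterModule Sel)) :=
  have h2 : ((2 : ℕ) : ℤ_[p]) ≠ 0 := by
    rw [Nat.cast_ofNat]
    exact two_ne_zero
  le_finrank_characterModule_of_intDualityData_of_nsmul S P H H2 pair locd Z Sel₀ e f B hB hpair hlocd h2 hEH horth hDH
    hfinH hfinP hi hii hPT

end AdapterAdditive

/-! ## §Z The (C3) value currency `ℤ/p^k → ℚ/ℤ`, `t ↦ t.val • p^{-k}` -/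

section Circle

/-- `N • t = 0` in `ℤ/p^k` forces `N • (t.val • p^{-k}) = 0` in `ℚ/ℤ` (`p^{-k}` has additive order `p^k`).
[cite: Kato2004Asterisque, §17.13 (p. 279)] -/
theorem nsmul_val_smul_invPow_eq_zero {p : ℕ} [Fact p.Prime] (k N : ℕ) (t : ZMod (p ^ k)) (h : N • t = 0) :
    N • (t.val • ((((p : ℚ) ^ k)⁻¹ : ℚ) : AddCircle (1 : ℚ))) = 0 := by
  haveI : NeZero (p ^ k) := ⟨pow_ne_zero k (Fact.out : p.Prime).ne_zero⟩
  have hord : addOrderOf ((((p : ℚ) ^ k)⁻¹ : ℚ) : AddCircle (1 : ℚ)) = p ^ k := by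
    have hpos : 0 < p ^ k := pow_pos (Fact.out : p.Prime).pos k
    have h1 := AddCircle.addOrderOf_div_of_gcd_eq_one (p := (1 : ℚ)) (m := 1) hpos (Nat.gcd_one_left _)
    simpa [one_div] using h1
  have hdvd : p ^ k ∣ N * t.val := by
    rw [← ZMod.natCast_eq_zero_iff, Nat.cast_mul, ZMod.natCast_zmod_val, ← nsmul_eq_mul]
    exact h
  rw [smul_smul]
  apply addOrderOf_dvd_iff_nsmul_eq_zero.mp
  rw [hord]
  exact hdvd

/-- The exact form: `t = 0` ⇒ `t.val • p^{-k} = 0`. [cite: Kato2004Asterisque, §17.13 (p. 279)] -/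
theorem val_smul_invPow_eq_zero {p : ℕ} (k : ℕ) (t : ZMod (p ^ k)) (h : t = 0) :
    t.val • ((((p : ℚ) ^ k)⁻¹ : ℚ) : AddCircle (1 : ℚ)) = 0 := by
  subst h
  rw [ZMod.val_zero, zero_smul]

end Circle

/-! ## §L The levelwise assembly of (EH) in the (C3)/(C5) currency -/

section Levelwise

open Literature.NumberTheory.EllipticCurves Literature.NumberTheory.EllipticCurves.CyclotomicLayer ZpExtension

variable {M : Type} [AddCommGroup M] [TopologicalSpace M] [DiscreteTopology M] [Finite M]
  (ρM : DiscreteGaloisModule ℚ M) (N : ℕ) [NeZero N]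
  (e : M → M → AlgebraicClosure ℚ)
  (hμ : ∀ S T, e S T ^ N = 1)
  (hadd₁ : ∀ S₁ S₂ T, e (S₁ + S₂) T = e S₁ T * e S₂ T)
  (hadd₂ : ∀ S T₁ T₂, e S (T₁ + T₂) = e S T₁ * e S T₂)
  (hgal : ∀ (σ : absoluteGaloisGroup ℚ) (S T : M), σ • e S T = e (ρM σ S) (ρM σ T))
  (κ : ZpExtension ℚ 2) (n : ℕ)

omit [Finite M] in
/-- **Levelwise (EH), `2 •` form (one layer `n`, one level `N = 2^k`), assembled.** For a global class `c ∈ H²(Γ_ℚ, μ_N)` (the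
Shapiro cup class `Sh_{Γ_n}^{Γ_ℚ} a ∪_{Σe} Sh_{Γ_n}^{Γ_ℚ} b`): if at each `v ∈ S₁` (`= {2} ∪ S₀`) its invariant is the ORBIT SUM of the
layer pairings of the conjugates (`hloc` — the one-orbit / all-orbit Mackey formulas `map_cupProduct_coindFin_shapiroLift[_sum]` followed by
`layerPairingH1Of_apply`), and its localisation vanishes at the finite `v ∉ S₁` (`hoff` — (ShU) + (U) of `CupProductLocalTermsShapiro`), then
`2 • Σ_{v ∈ S₁} Σ_i ⟨loc_n(g_{v,i} · a), loc_n(g_{v,i} · b)⟩_{n,N,v} = 0` (`two_nsmul_sum_localInvariantMap_eq_zero_of_localization_eq_zero`).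
[cite: Kobayashi2003, (7.16)–(7.21) (p. 12)] [cite: Kato2004Asterisque, §17.13 (p. 279)] [cite: MilneADT2006, Ch. I, Thm. 4.10(b)] -/
theorem two_nsmul_sum_orbit_layerPairingH1Of_eq_zero (c : galoisCohomology (mu ℚ N) 2)
    (a b : H1 ρM (κ.layerSubgroup n)) (S₁ : Finset (HeightOneSpectrum (𝓞 ℚ)))
    (ι : HeightOneSpectrum (𝓞 ℚ) → Type) [∀ v, Fintype (ι v)] (g : ∀ v, ι v → absoluteGaloisGroup ℚ)
    (hloc : ∀ v ∈ S₁, localInvariantMap ℚ N v (galoisCohomology.localization (mu ℚ N) (Sum.inr v) 2 c) =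
      ∑ i, layerPairingH1Of ρM N e hμ hadd₁ hadd₂ hgal κ v n
        (layerLocOf ρM κ v n (conjMap ρM.toTopRep (κ.layerSubgroup n) (g v i) 1 a))
        (layerLocOf ρM κ v n (conjMap ρM.toTopRep (κ.layerSubgroup n) (g v i) 1 b)))
    (hoff : ∀ v : HeightOneSpectrum (𝓞 ℚ), v ∉ S₁ → galoisCohomology.localization (mu ℚ N) (Sum.inr v) 2 c = 0) :
    2 • ∑ v ∈ S₁, ∑ i, layerPairingH1Of ρM N e hμ hadd₁ hadd₂ hgal κ v n
        (layerLocOf ρM κ v n (conjMap ρM.toTopRep (κ.layerSubgroup n) (g v i) 1 a))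
        (layerLocOf ρM κ v n (conjMap ρM.toTopRep (κ.layerSubgroup n) (g v i) 1 b)) = 0 := by
  rw [← Finset.sum_congr rfl hloc]
  exact two_nsmul_sum_localInvariantMap_eq_zero_of_localization_eq_zero ℚ N S₁ c hoff

omit [Finite M] in
/-- **Levelwise (EH), EXACT form**: as above, and the localisations of `c` at the infinite places vanish as classes (S-A at finite
level: `H¹(⟨c_y⟩, ·) = 0` for every conjugate complex conjugation, `map_shapiroLift_eq_zero_of_reps` along `Γ_ℝ → Γ_ℚ`) — then
`Σ_{v ∈ S₁} Σ_i ⟨loc_n(g_{v,i} · a), loc_n(g_{v,i} · b)⟩_{n,N,v} = 0` on the nose (`sum_localInvariantMap_eq_zero_of_localization_inl_eq_zero`).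
[cite: Kobayashi2003, (7.16)–(7.21) (p. 12)] [cite: MilneADT2006, Ch. I, Thm. 4.10(b)] -/
theorem sum_orbit_layerPairingH1Of_eq_zero_of_localization_inl_eq_zero (c : galoisCohomology (mu ℚ N) 2)
    (a b : H1 ρM (κ.layerSubgroup n)) (S₁ : Finset (HeightOneSpectrum (𝓞 ℚ)))
    (ι : HeightOneSpectrum (𝓞 ℚ) → Type) [∀ v, Fintype (ι v)] (g : ∀ v, ι v → absoluteGaloisGroup ℚ)
    (hloc : ∀ v ∈ S₁, localInvariantMap ℚ N v (galoisCohomology.localization (mu ℚ N) (Sum.inr v) 2 c) =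
      ∑ i, layerPairingH1Of ρM N e hμ hadd₁ hadd₂ hgal κ v n
        (layerLocOf ρM κ v n (conjMap ρM.toTopRep (κ.layerSubgroup n) (g v i) 1 a))
        (layerLocOf ρM κ v n (conjMap ρM.toTopRep (κ.layerSubgroup n) (g v i) 1 b)))
    (hoff : ∀ v : HeightOneSpectrum (𝓞 ℚ), v ∉ S₁ →
      localInvariantMap ℚ N v (galoisCohomology.localization (mu ℚ N) (Sum.inr v) 2 c) = 0)
    (hinf : ∀ w : InfinitePlace ℚ, galoisCohomology.localization (mu ℚ N) (Sum.inl w) 2 c = 0) :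
    ∑ v ∈ S₁, ∑ i, layerPairingH1Of ρM N e hμ hadd₁ hadd₂ hgal κ v n
        (layerLocOf ρM κ v n (conjMap ρM.toTopRep (κ.layerSubgroup n) (g v i) 1 a))
        (layerLocOf ρM κ v n (conjMap ρM.toTopRep (κ.layerSubgroup n) (g v i) 1 b)) = 0 := by
  rw [← Finset.sum_congr rfl hloc]
  exact sum_localInvariantMap_eq_zero_of_localization_inl_eq_zero ℚ N S₁ c hoff hinf

end Levelwise

end Summit.BirchSwinnertonDyer.BirchSwinnertonDyer.Theorems.ReciprocityReceptacle

end
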